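import Literature.GroupTheory.CombinatorialGroupTheory.PushoutITreeQuotient
import HarnessLib

/-!
# Loops in the quotient `N \ T` of the Bass–Serre tree of `∗_H G_i`: values in `N` and injectivity

Topic `Literature/GroupTheory/CombinatorialGroupTheory`; theorems only (no definitions), first proof
file over the data of `PushoutITreeQuotient.lean` (`P = Monoid.PushoutI φ`, `N ⊴ P`, the quotient star
quiver `N \ T` of the Bass–Serre tree and its labelling functor `F : FreeGroupoid (N \ T) ⥤ P`).
Following Serre, *Trees* I §3.3 (proof of Thm. 4) on the quotient graph:

* the key congruence `out_inv_mul_out_mul_inv_mem`: for central classes `c, c'` with the same `i`-th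
  arm class, `r(c')⁻¹ r(c) ≡ of i ((label i c')⁻¹ label i c)` modulo `N`; hence, when `N ∩ G_i = 1`
  is not even needed, `c ≠ c'` forces the combined label out of the amalgamated subgroup `H`
  (`inv_label_mul_label_not_mem_range`);
* (C1) `fval_mul_mem` / `fval_loop_mem`: path values are transport elements modulo `N`; loops are
  mapped into `N`;
* (C2) `exists_word_of_isReduced`: a REDUCED zigzag between central vertices (Stallings' normal form of
  the tree file `FreeGroupoidWords`) reads a reduced word of the amalgam (Mathlib's
  `Monoid.PushoutI.Reduced`), so by the normal form theorem for amalgams (Serre I §1.2 Thm. 1 =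
  Mathlib's `Reduced.eq_empty_of_mem_range`) a loop with trivial value is trivial
  (`eq_one_of_fval_eq_one`): `F` is injective on every vertex group.

The sequel `FiniteAmalgamVirtuallyFree.lean` adds surjectivity onto `N` and concludes that `N` is free.

## References
* J.-P. Serre, *Trees*, Springer (1980), Ch. I §1.2 Thm. 1, §3.3 Thm. 4, §4.1 Thm. 7. [SerreTrees1980]
* J. R. Stallings, *Topology of finite graphs*, Invent. Math. 71 (1983), Prop. 5.2. [Stallings1983]
-/

namespace Literature.GroupTheory.CombinatorialGroupTheory

universe u v w

namespace PushoutITree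

open Monoid Monoid.PushoutI Function CategoryTheory FreeGroupoidWords

variable {ι : Type u} {G : ι → Type v} [∀ i, Group (G i)] {H : Type w} [Group H]
  {φ : ∀ i, H →* G i} {N : Subgroup (PushoutI φ)}

/-! ### The key congruence between labels and representatives -/

/-- Key computation: for two central classes `c, c'` with the same `i`-th arm class,
`r(c')⁻¹ r(c) ≡ of i ((label i c')⁻¹ * label i c)` modulo `N` (on the left). [cite: SerreTrees1980, I §3.3 Thm. 4] -/
theorem out_inv_mul_out_mul_inv_mem [N.Normal] {i : ι} {c c' : CenterClass N}
    (h : armOf N i c = armOf N i c') :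
    (c'.out)⁻¹ * c.out * (of i ((label N i c')⁻¹ * label N i c))⁻¹ ∈ N := by
  have hc := label_spec (N := N) i c
  have hc' := label_spec (N := N) i c'
  rw [← h] at hc'
  have := N.mul_mem (N.inv_mem hc') hc
  have := ‹N.Normal›.conj_mem _ this (of i (label N i c'))⁻¹
  convert this using 1
  simp only [map_mul, map_inv]
  group

/-- If moreover `c ≠ c'`, the combined label is not in the amalgamated subgroup `H` (else
`r(c')⁻¹ r(c) ∈ N·H`, i.e. `c = c'`). [cite: SerreTrees1980, I §3.3 Thm. 4] -/
theorem inv_label_mul_label_not_mem_range [N.Normal]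
    {i : ι} {c c' : CenterClass N} (h : armOf N i c = armOf N i c') (hne : c ≠ c') :
    (label N i c')⁻¹ * label N i c ∉ (φ i).range := by
  rintro ⟨x, hx⟩
  have hm := out_inv_mul_out_mul_inv_mem (N := N) h
  rw [← hx, of_apply_eq_base] at hm
  have hmem : (c'.out)⁻¹ * c.out ∈ centerStab N :=
    (mem_sup_iff_of_normal _ _).mpr ⟨PushoutI.base φ x, ⟨x, rfl⟩, hm⟩
  rw [← QuotientGroup.eq, QuotientGroup.out_eq', QuotientGroup.out_eq'] at hmem
  exact hne hmem.symm

/-! ### (C1) The functor maps loops into `N` -/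

/-- **Path values are transport elements modulo `N`**: for a zigzag `γ : X ⇝ Y` of `N \ T`,
`F(γ) · rep(X)⁻¹ · rep(Y) ∈ N` (induction on the path; each arrow contributes its defining
congruence `label_spec`). [cite: SerreTrees1980, I §3.3 Thm. 4] -/
theorem fval_mul_mem [N.Normal] {X : Quiver.Symmetrify (quotQuiv N)} :
    ∀ {Y : Quiver.Symmetrify (quotQuiv N)} (γ : Quiver.Path X Y),
      fval N (homMk γ) * (vertexRep N X)⁻¹ * vertexRep N Y ∈ N
  | _, Quiver.Path.nil => by
    rw [fval_nil, one_mul, inv_mul_cancel]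
    exact N.one_mem
  | _, Quiver.Path.cons γ f => by
    have ih := fval_mul_mem γ
    rw [fval_cons]
    cases f with
    | inl e =>
      cases e with
      | mk i c d h =>
        subst h
        rw [fval_toPos]
        have h2 := N.inv_mem (label_spec (N := N) i c)
        have h1 := ‹N.Normal›.conj_mem _ ih (of i (label N i c))
        convert N.mul_mem h1 h2 using 1
        simp only [QuotArrow.label, vertexRep]
        group
    | inr e =>
      cases e with
      | mk i c d h =>
        subst h
        rw [fval_toNeg]
        have h2 := ‹N.Normal›.conj_mem _ (label_spec (N := N) i c) (of i (label N i c))⁻¹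
        have h1 := ‹N.Normal›.conj_mem _ ih (of i (label N i c))⁻¹
        convert N.mul_mem h1 h2 using 1
        simp only [QuotArrow.label, vertexRep]
        group

/-- **(C1)** The labelling functor maps every LOOP of `N \ T` into `N`. [cite: SerreTrees1980, I §3.3 Thm. 4] -/
theorem fval_loop_mem [N.Normal] {X : Quiver.Symmetrify (quotQuiv N)} (x : End (obj X)) :
    fval N x ∈ N := by
  obtain ⟨γ, rfl⟩ := homMk_surjective (x : obj X ⟶ obj X)
  simpa using fval_mul_mem (N := N) γ

/-! ### (C2) Injectivity on loops: reduced zigzags read reduced words of the amalgam -/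

/-- The value of a two-step zigzag `center c' → arm i d ← center c` appended to a path.
[cite: SerreTrees1980, I §3.3 Thm. 4] -/
theorem fval_cons_fwd_cons_bwd {X : Quiver.Symmetrify (quotQuiv N)} {i : ι} {c c' : CenterClass N}
    {d : ArmClass N i} (γ : Quiver.Path X (ctrS N c')) (h' : armOf N i c' = d) (h : armOf N i c = d) :
    fval N (homMk ((γ.cons (fwd N i c' d h')).cons (bwd N i c d h))) =
      of i ((label N i c)⁻¹ * label N i c') * fval N (homMk γ) := by
  rw [fval_cons, fval_cons, ← mul_assoc]
  congr 1
  rw [map_mul, map_inv]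
  exact congrArg₂ (· * ·) (fval_toNeg (N := N) (QuotArrow.mk i c d h))
    (fval_toPos (N := N) (QuotArrow.mk i c' d h'))

/-- Two consecutive arrows `center c' → arm i d ← center c` of a REDUCED zigzag have `c ≠ c'`.
[cite: SerreTrees1980, I §3.3 Thm. 4] -/
theorem ne_of_isReduced_fwd_bwd {X : Quiver.Symmetrify (quotQuiv N)} {i : ι} {c c' : CenterClass N}
    {d : ArmClass N i} (γ : Quiver.Path X (ctrS N c')) (h' : armOf N i c' = d) (h : armOf N i c = d)
    (hred : FreeGroupoidWords.IsReduced ((γ.cons (fwd N i c' d h')).cons (bwd N i c d h))) :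
    c ≠ c' := by
  rintro rfl
  obtain ⟨h1, -⟩ := (isReduced_cons_cons_iff _ _ _).mp hred
  exact absurd (h1 rfl) (by simp [letter])

/-- Two consecutive arrows `arm j d' ← center c → arm i d` of a REDUCED zigzag have `i ≠ j`.
[cite: SerreTrees1980, I §3.3 Thm. 4] -/
theorem ne_of_isReduced_bwd_fwd {X : Quiver.Symmetrify (quotQuiv N)} {i j : ι} {c : CenterClass N}
    {d : ArmClass N i} {d' : ArmClass N j} (γ : Quiver.Path X (armS N j d'))
    (h' : armOf N j c = d') (h : armOf N i c = d)
    (hred : FreeGroupoidWords.IsReduced ((γ.cons (bwd N j c d' h')).cons (fwd N i c d h))) :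
    i ≠ j := by
  rintro rfl
  subst h' h
  obtain ⟨h1, -⟩ := (isReduced_cons_cons_iff _ _ _).mp hred
  exact absurd (h1 rfl) (by simp [letter])

/-- The empty word describes the empty path. [cite: SerreTrees1980, I §1.2 Thm. 1] -/
theorem exists_word_nil (c₀ : CenterClass N) :
    ∃ w : CoprodI.Word G, Reduced φ w ∧
      ofCoprodI w.prod = fval N (homMk (Quiver.Path.nil : Quiver.Path (ctrS N c₀) (ctrS N c₀))) ∧
      w.fstIdx = lastIdx N (Quiver.Path.nil : Quiver.Path (ctrS N c₀) (ctrS N c₀)) ∧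
      (Quiver.Path.nil : Quiver.Path (ctrS N c₀) (ctrS N c₀)).length = 2 * w.toList.length :=
  ⟨CoprodI.Word.empty, fun _ h => by simp at h,
    by rw [CoprodI.Word.prod_empty, map_one, fval_nil], rfl, rfl⟩

/-- **Reduced zigzags read reduced words.**  A reduced zigzag path between central vertices of
`N \ T` of length `2m` is mapped by the labelling functor to the product of a reduced word of length
`m` of the amalgam in the sense of Mathlib's `Monoid.PushoutI.Reduced` (no letter in the amalgamated
subgroup, consecutive letters in different factors); the first letter records the last arm visited.
[cite: SerreTrees1980, I §1.2 Thm. 1] -/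
theorem exists_word_of_isReduced [N.Normal] (c₀ : CenterClass N) :
    ∀ (n : ℕ) {c : CenterClass N} (γ : Quiver.Path (ctrS N c₀) (ctrS N c)),
      γ.length ≤ n → FreeGroupoidWords.IsReduced γ →
      ∃ w : CoprodI.Word G, Reduced φ w ∧ ofCoprodI w.prod = fval N (homMk γ) ∧
        w.fstIdx = lastIdx N γ ∧ γ.length = 2 * w.toList.length := by
  intro n
  induction n with
  | zero =>
    intro c γ hlen _
    cases γ with
    | nil => exact exists_word_nil c₀
    | cons γ f => simp at hlen
  | succ n ih =>
    intro c γ hlen hred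
    cases γ with
    | nil => exact exists_word_nil c₀
    | cons γ₁ f =>
      cases f with
      | inl e => cases e
      | inr e =>
        cases e with
        | mk i c d h =>
          cases γ₁ with
          | cons γ₂ f₂ =>
            cases f₂ with
            | inr e₂ => cases e₂
            | inl e₂ =>
              cases e₂ with
              | mk i' c' d' h' =>
                -- the path is `γ₂ · (i, c')⁺ · (i, c)⁻` with `γ₂ : c₀ ⇝ c'`
                change Quiver.Path (ctrS N c₀) (ctrS N c') at γ₂
                have hcc' : c ≠ c' := ne_of_isReduced_fwd_bwd γ₂ h' h hred
                have hred₂ : FreeGroupoidWords.IsReduced (Quiver.Path.cons γ₂ (fwd N i c' d h')) :=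
                  hred.of_cons
                have hlen₂ : γ₂.length ≤ n := by
                  change γ₂.length + 1 + 1 ≤ n + 1 at hlen
                  omega
                obtain ⟨w₂, hw₂red, hw₂prod, hw₂fst, hw₂len⟩ := ih γ₂ hlen₂ hred₂.of_cons
                have harm : armOf N i c = armOf N i c' := h.trans h'.symm
                have hx : (label N i c)⁻¹ * label N i c' ∉ (φ i).range :=
                  inv_label_mul_label_not_mem_range harm.symm hcc'.symm
                have hx1 : (label N i c)⁻¹ * label N i c' ≠ 1 := fun h1 =>
                  hx ⟨1, by rw [map_one, h1]⟩
                have hfst : w₂.fstIdx ≠ some i := by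
                  rw [hw₂fst]
                  cases γ₂ with
                  | nil => simp [lastIdx]
                  | cons γ₃ f₃ =>
                    cases f₃ with
                    | inl e₃ => cases e₃
                    | inr e₃ =>
                      cases e₃ with
                      | mk j c'' d₃ h₃ =>
                        have hij : i ≠ j := ne_of_isReduced_bwd_fwd γ₃ h₃ h' hred₂
                        simpa [lastIdx, armIdx] using hij.symm
                refine ⟨CoprodI.Word.cons ((label N i c)⁻¹ * label N i c') w₂ hfst hx1,
                  ?_, ?_, ?_, ?_⟩
                · intro l hl
                  simp only [CoprodI.Word.cons_toList, List.mem_cons] at hl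
                  rcases hl with rfl | hl
                  · exact hx
                  · exact hw₂red l hl
                · rw [CoprodI.Word.prod_cons, map_mul, ofCoprodI_of, hw₂prod]
                  exact (fval_cons_fwd_cons_bwd γ₂ h' h).symm
                · simp [lastIdx, armIdx]
                · change γ₂.length + 1 + 1 = 2 * (List.length (_ :: w₂.toList))
                  rw [List.length_cons]
                  omega

/-- **(C2) Injectivity**: a loop of the free groupoid at a central vertex with trivial value is trivial —
its reduced representative (Stallings) reads a reduced word of the amalgam with trivial product, which is
empty by the normal form theorem (Mathlib's `Monoid.PushoutI.Reduced.eq_empty_of_mem_range`).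
[cite: SerreTrees1980, I §1.2 Thm. 1] -/
theorem eq_one_of_fval_eq_one [N.Normal] (hφ : ∀ i, Injective (φ i)) (c₀ : CenterClass N)
    (x : End (obj (ctrS N c₀))) (hx : fval N x = 1) : x = 1 := by
  obtain ⟨γ, hγred, hγ⟩ := exists_isReduced_homMk_eq (x : obj (ctrS N c₀) ⟶ obj (ctrS N c₀))
  obtain ⟨w, hwred, hwprod, -, hwlen⟩ :=
    exists_word_of_isReduced c₀ γ.length γ le_rfl hγred
  have hw : w = CoprodI.Word.empty :=
    Reduced.eq_empty_of_mem_range hφ hwred (by rw [hwprod, hγ, hx]; exact one_mem _)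
  subst hw
  have h0 : γ.length = 0 := by simpa using hwlen
  obtain rfl := Quiver.Path.eq_nil_of_length_zero γ h0
  rw [← hγ, homMk_nil]
  rfl

end PushoutITree

end Literature.GroupTheory.CombinatorialGroupTheory
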